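import Summits.BirchSwinnertonDyer.BirchSwinnertonDyer.Theorems.SchneiderFreeAdditiveX3PoitouTateSelmerComplementCanonical
import Summits.BirchSwinnertonDyer.BirchSwinnertonDyer.Theorems.SchneiderFreeAdditiveX3PoitouTateMiddleExactDualSymmetry
import HarnessLib

/-!
# Route `KolyvaginRoadThree`, deciding crux `ZhangSharpFrameAtThreeHL` (item stmt-BirchSwinnertonDyer-19574):
# PT road, step (R) part 1 — Poitou–Tate duality for Selmer structures AT ONE MODULE from Milne's basic middle
# exactness FOR THAT MODULE ALONE (cell `bsd-stepL`, ACCEL seat `bsd-stepL-koly3b` g10;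
# `--supports stmt-BirchSwinnertonDyer-19574`, helper)

HONEST FRAMING. Theorems only; 0 definitions, 0 named facts, 0 `sorry`; proves no case of Poitou–Tate duality by itself
and no case of BSD; closes nothing (T7). PARTITION: O2@3 (B10) × A1 × crux 19574 × stub PT's consumer chain — proves-glue.

WHY. The owner's PT road (koly g18–g20) proves Milne *ADT* I Thm. 4.10(b) `Ker γ¹ ⊆ Im β¹` («basic middle exactness»,
`hE(M, S)`) for THE invariant maps `LocalInvariants.canonical K p` and the ONE module `M = E[3]` (dévissage over
`K' = K(E[3])^{Syl₃}` + prime-to-`p` descent, certificate `middleExact_canonical_of_descentData`). The S2-ENGINE chain of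
crux 19574 (koly3b parts XI–XXVII) consumes the named ∀-module fact `poitouTate_selmerStructure_duality K` only through the
conjunct `SelmerComplement` (Howard 2004 Thm. 2.1.11, both inclusions) AT `ρ = E[3]` (n1011's `card_selmerGroup_pair`).
The tree's reduction `selmerComplement_of_middleExact` (door-c6 g5) needs BOTH `hE(M, S)` and the dual statement
`hE'(M, S)` (`M^D`, `M` on the left of the pairing), for ALL `M`; and of the two basic statements only the direction
`hE' ⟹ hE` is in the tree (door-c6 g7 `middleExact_of_dualMiddleExact`). This file supplies the converse and the AT-ONE-
MODULE packaging, so that `hE(E[3], S)` for all admissible `S` ALONE feeds the chain (parts 2–5 of step (R)):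
* §1 `dualMiddleExact_of_middleExact` — `hE(M, S) ⟹ hE'(M, S)` for a family perfect at the finite places and injective at
  the real places: in the perfect pairing `⊕_{v∈S} H¹(K_v, M) × ⊕_{v∈S} H¹(K_v, M^D) → ℤ/n`, `hE` reads `{}^⊥(L^D) ≤ L`
  (`L = loc H¹_S(K, M)`, `L^D = loc H¹_S(K, M^D)`), hence `L^⊥ ≤ ({}^⊥(L^D))^⊥ = L^D` (double annihilator, Milne I 0.19).
* §2 `selmerComplementAt_of_middleExact` — for a family perfect, injective at the real places and unramified-orthogonal
  (Milne I 2.6): `hE(ρ, S)` at every admissible `S ⊇ ∞` implies the BODY of `LocalInvariants.SelmerComplement` at `ρ`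
  (both Howard inclusions, every admissible `S`, every pair `𝓕 ≤ 𝓖` unramified outside `S`).
* §3 `selmerComplementAt_canonical_of_middleExact` — the same for THE invariant maps `LocalInvariants.canonical K n` of a
  `K : Type` at a prime-power level (`canonical_isPerfect`, `canonical_injectiveAtRealPlaces`, n1011's
  `UnramifiedCup.unramifiedOrthogonal_of_isPerfect`): the E[3]-specific input of step (R) is EXACTLY `hE(E[3], ·)`.

References: [cite: MilneADT2006, Ch. I, Prop. 0.19, Cor. 2.3, Thm. 2.6, Thm. 4.10(b)] [cite: Howard2004HeegnerKolyvagin,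
Thm. 2.1.11 (arXiv:1202.6340 p. 6)] [cite: Rubin2000, Thm. 1.7.3].
-/

noncomputable section

open Function NumberField IsDedekindDomain
open scoped NumberField

universe u

namespace Summit.BirchSwinnertonDyer.Rank1Residual.X11b.Three.Koly.PTAt

open Field
open Literature.NumberTheory.GaloisRepresentations Literature.NumberTheory.GaloisCohomology
open Literature.NumberTheory.GaloisRepresentations.DiscreteGaloisModule (mu TateDual tateDual localTatePairingZMod
  unramifiedSubgroup SelmerStructure)
open Summit.BirchSwinnertonDyer.Rank1Residual.X11b
open Summit.BirchSwinnertonDyer.Rank1Residual.X11b.FiniteDuality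
open Summit.BirchSwinnertonDyer.BirchSwinnertonDyer.Theorems.SchneiderFreeAdditiveX3.PoitouTateReduction

/-! ## §1. The basic exactness for `(M, S)` implies its dual form for `(M, S)` -/

section PrimalToDual

variable {K : Type u} [Field K] [NumberField K] {n : ℕ} [NeZero n]
variable {M : Type u} [AddCommGroup M] [TopologicalSpace M] [DiscreteTopology M] [Finite M]

/-- **The DUAL form of Milne I Thm. 4.10(b) for `(M, S)` from the basic form for `(M, S)`.** For a family `inv` of
local invariant maps perfect at the finite places and injective at the real places, a finite `n`-torsion `M` and a
finite set of places `S`: if every family `t ∈ ⊕_{v∈S} H¹(K_v, M)` with `∑_{v∈S} ⟨t_v, y_v⟩_v = 0` for all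
`y ∈ H¹(K, M^D)` unramified outside `S` is the localisation on `S` of a class of `H¹(K, M)` unramified outside `S`
(hypothesis `hE`), then every family `u ∈ ⊕_{v∈S} H¹(K_v, M^D)` with `∑_{v∈S} ⟨x_v, u_v⟩_v = 0` for all `x ∈ H¹(K, M)`
unramified outside `S` is the localisation on `S` of a class of `H¹(K, M^D)` unramified outside `S`. Proof: in the
perfect pairing of the finite groups `⊕_{v∈S} H¹(K_v, M) × ⊕_{v∈S} H¹(K_v, M^D) → ℤ/n`, `hE` reads `{}^⊥(L^D) ≤ L` for
`L = loc(H¹_S(K, M))`, `L^D = loc(H¹_S(K, M^D))`; so `L^⊥ ≤ ({}^⊥(L^D))^⊥ = L^D` by the double annihilator (Milne I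
Prop. 0.19). Converse of door-c6 g7's `middleExact_of_dualMiddleExact`.
[cite: MilneADT2006, Ch. I, Thm. 4.10(b) and Prop. 0.19] -/
theorem dualMiddleExact_of_middleExact (inv : LocalInvariants K n) (hperf : inv.IsPerfect)
    (hreal : inv.InjectiveAtRealPlaces) (ρ : DiscreteGaloisModule K M) (hM : ∀ m : M, n • m = 0)
    {S : Finset (Place K)}
    (hE : ∀ t : Π v : Place K, galoisCohomology (ρ.toLocal v) 1,
      (∀ y : galoisCohomology (ρ.tateDual n) 1,
        (∀ v : HeightOneSpectrum (𝓞 K), (Sum.inr v : Place K) ∉ S →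
          galoisCohomology.localization (ρ.tateDual n) (Sum.inr v) 1 y ∈
            unramifiedSubgroup (GaloisRep.toLocal v (ρ.tateDual n)) 1) →
        ∑ v ∈ S, localTatePairingZMod ρ n v (inv v) (t v)
          (galoisCohomology.localization (ρ.tateDual n) v 1 y) = 0) →
      ∃ x : galoisCohomology ρ 1,
        (∀ v : HeightOneSpectrum (𝓞 K), (Sum.inr v : Place K) ∉ S →
          galoisCohomology.localization ρ (Sum.inr v) 1 x ∈ unramifiedSubgroup (GaloisRep.toLocal v ρ) 1) ∧
        ∀ v ∈ S, galoisCohomology.localization ρ v 1 x = t v)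
    (u : Π v : Place K, galoisCohomology ((ρ.tateDual n).toLocal v) 1)
    (horth : ∀ x : galoisCohomology ρ 1,
      (∀ v : HeightOneSpectrum (𝓞 K), (Sum.inr v : Place K) ∉ S →
        galoisCohomology.localization ρ (Sum.inr v) 1 x ∈ unramifiedSubgroup (GaloisRep.toLocal v ρ) 1) →
      ∑ v ∈ S, localTatePairingZMod ρ n v (inv v) (galoisCohomology.localization ρ v 1 x) (u v) = 0) :
    ∃ y : galoisCohomology (ρ.tateDual n) 1,
      (∀ v : HeightOneSpectrum (𝓞 K), (Sum.inr v : Place K) ∉ S →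
        galoisCohomology.localization (ρ.tateDual n) (Sum.inr v) 1 y ∈
          unramifiedSubgroup (GaloisRep.toLocal v (ρ.tateDual n)) 1) ∧
      ∀ v ∈ S, galoisCohomology.localization (ρ.tateDual n) v 1 y = u v := by
  classical
  -- finiteness and `n`-torsion of the local groups over `S`
  haveI : ∀ i : ↥S, Finite (galoisCohomology (ρ.toLocal (i : Place K)) 1) := fun i =>
    finite_galoisCohomology_one_toLocal_place ρ i
  haveI : ∀ i : ↥S, Finite (galoisCohomology ((ρ.tateDual n).toLocal (i : Place K)) 1) := fun i =>
    finite_galoisCohomology_one_tateDual_toLocal_place ρ i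
  have hAn : ∀ p : Π i : ↥S, galoisCohomology (ρ.toLocal (i : Place K)) 1, n • p = 0 :=
    pi_nsmul_eq_zero fun i x => galoisCohomology.nsmul_eq_zero_of_forall _ hM x
  have hBn : ∀ q : Π i : ↥S, galoisCohomology ((ρ.tateDual n).toLocal (i : Place K)) 1, n • q = 0 :=
    pi_nsmul_eq_zero fun i y => galoisCohomology.nsmul_eq_zero_of_forall _
      (fun f => DiscreteGaloisModule.TateDual.nsmul_eq_zero f) y
  -- the sum pairing over `S` and its perfectness
  obtain ⟨b, hb⟩ := exists_piPairing
    (fun i : ↥S => localTatePairingZMod ρ n (i : Place K) (inv (i : Place K)))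
  have hloc := fun i : ↥S => bijective_localTatePairingZMod_place inv hperf hreal ρ hM (i : Place K)
  obtain ⟨hbij, hbijflip⟩ := AddMonoidHom.bijective_of_injective_of_injective_flip hAn hBn b
    (piPairing_injective hb fun i => (hloc i).1.1) (piPairing_flip_injective hb fun i => (hloc i).2.1)
  -- localisation to `S`
  let locS : galoisCohomology ρ 1 →+ Π i : ↥S, galoisCohomology (ρ.toLocal (i : Place K)) 1 :=
    AddMonoidHom.pi fun i : ↥S => galoisCohomology.localization ρ (i : Place K) 1
  let locSD : galoisCohomology (ρ.tateDual n) 1 →+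
      Π i : ↥S, galoisCohomology ((ρ.tateDual n).toLocal (i : Place K)) 1 :=
    AddMonoidHom.pi fun i : ↥S => galoisCohomology.localization (ρ.tateDual n) (i : Place K) 1
  -- classes unramified outside `S`
  let HS : AddSubgroup (galoisCohomology ρ 1) :=
    ⨅ (v : HeightOneSpectrum (𝓞 K)) (_ : (Sum.inr v : Place K) ∉ S),
      (unramifiedSubgroup (GaloisRep.toLocal v ρ) 1).comap
        (galoisCohomology.localization ρ (Sum.inr v) 1)
  let HSD : AddSubgroup (galoisCohomology (ρ.tateDual n) 1) :=
    ⨅ (v : HeightOneSpectrum (𝓞 K)) (_ : (Sum.inr v : Place K) ∉ S),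
      (unramifiedSubgroup (GaloisRep.toLocal v (ρ.tateDual n)) 1).comap
        (galoisCohomology.localization (ρ.tateDual n) (Sum.inr v) 1)
  have memHS : ∀ x, x ∈ HS ↔ ∀ v : HeightOneSpectrum (𝓞 K), (Sum.inr v : Place K) ∉ S →
      galoisCohomology.localization ρ (Sum.inr v) 1 x ∈ unramifiedSubgroup (GaloisRep.toLocal v ρ) 1 :=
    fun x => by simp only [HS, AddSubgroup.mem_iInf, AddSubgroup.mem_comap]; exact Iff.rfl
  have memHSD : ∀ y, y ∈ HSD ↔ ∀ v : HeightOneSpectrum (𝓞 K), (Sum.inr v : Place K) ∉ S →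
      galoisCohomology.localization (ρ.tateDual n) (Sum.inr v) 1 y ∈
        unramifiedSubgroup (GaloisRep.toLocal v (ρ.tateDual n)) 1 :=
    fun y => by simp only [HSD, AddSubgroup.mem_iInf, AddSubgroup.mem_comap]; exact Iff.rfl
  -- `hE`: `{}^⊥(L^D) ≤ L`
  have h1 : annLeft b (HSD.map locSD) ≤ HS.map locS := by
    intro p hp
    let t₀ : Π v : Place K, galoisCohomology (ρ.toLocal v) 1 := fun v =>
      if h : v ∈ S then p ⟨v, h⟩ else 0
    have ht₀ : ∀ i : ↥S, t₀ i = p i := fun i => by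
      simp only [t₀, dif_pos i.2]
    obtain ⟨x, hxur, hxS⟩ := hE t₀ fun y hy => by
      have hq : locSD y ∈ HSD.map locSD := AddSubgroup.mem_map_of_mem _ ((memHSD y).2 hy)
      have h0 := (mem_annLeft_iff b _ p).1 hp _ hq
      rw [hb] at h0
      rw [← Finset.sum_coe_sort]
      refine Eq.trans (Finset.sum_congr rfl fun i _ => ?_) h0
      rw [ht₀ i]
      rfl
    refine ⟨x, (memHS x).2 hxur, funext fun i => ?_⟩
    rw [AddMonoidHom.pi_apply, hxS i i.2, ht₀ i]
  -- hence `L^⊥ ≤ ({}^⊥(L^D))^⊥ = L^D`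
  have h2 : annRight b (HS.map locS) ≤ HSD.map locSD :=
    (annRight_anti b h1).trans (le_of_eq (annRight_annLeft hAn hBn b hbij hbijflip _))
  -- `u|_S ∈ L^⊥`
  have hu : (fun i : ↥S => u i) ∈ annRight b (HS.map locS) := by
    rw [mem_annRight_iff]
    intro p hp
    obtain ⟨x, hx, rfl⟩ := AddSubgroup.mem_map.1 hp
    have h0 := horth x ((memHS x).1 hx)
    rw [← Finset.sum_coe_sort S] at h0
    rw [hb]
    exact h0
  obtain ⟨y, hy, hyu⟩ := AddSubgroup.mem_map.1 (h2 hu)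
  refine ⟨y, (memHSD y).1 hy, fun v hv => ?_⟩
  have h3 := congr_fun hyu ⟨v, hv⟩
  rwa [AddMonoidHom.pi_apply] at h3

end PrimalToDual

/-! ## §2. Howard's Thm. 2.1.11 AT ONE MODULE from the basic exactness for that module -/

section AtRho

variable {K : Type u} [Field K] [NumberField K] {n : ℕ} [NeZero n]
variable {M : Type u} [AddCommGroup M] [TopologicalSpace M] [DiscreteTopology M] [Finite M]

/-- **Poitou–Tate duality for Selmer structures AT ONE MODULE (the body of `LocalInvariants.SelmerComplement` at `ρ`:
Howard 2004 Thm. 2.1.11, both inclusions «annihilator ⊆ image», every admissible `S` and every pair `𝓕 ≤ 𝓖` of Selmer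
structures on `M` unramified outside `S`) from Milne I Thm. 4.10(b) `Ker γ¹ ⊆ Im β¹` FOR `M` ALONE** — for a family `inv`
that is a local Tate duality at the finite places (`IsPerfect`), injective at the real places (`InjectiveAtRealPlaces`)
and satisfies Milne I Thm. 2.6 (`UnramifiedOrthogonal`). Inclusion (i) is door-c6 g5's `exists_selmer_sub_mem_of_middleExact`;
inclusion (ii) is its `exists_dualSelmer_sub_mem_of_middleExact` fed by §1 (`hE ⟹ hE'` at the same `S`). The hypothesis
`hE` is asked only at the admissible `S` containing the infinite places.
[cite: Howard2004HeegnerKolyvagin, Thm. 2.1.11 (arXiv:1202.6340 p. 6)] [cite: MilneADT2006, Ch. I, Thm. 4.10(b), Thm. 2.6, Prop. 0.19] -/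
theorem selmerComplementAt_of_middleExact (inv : LocalInvariants K n) (hperf : inv.IsPerfect)
    (hreal : inv.InjectiveAtRealPlaces) (hUO : inv.UnramifiedOrthogonal)
    (ρ : DiscreteGaloisModule K M) (hM : ∀ m : M, n • m = 0)
    (hE : ∀ S : Finset (Place K), (∀ w : InfinitePlace K, (Sum.inl w : Place K) ∈ S) →
      (∀ v : HeightOneSpectrum (𝓞 K), (Sum.inr v : Place K) ∉ S →
        ((n : ℕ) : 𝓞 K) ∉ v.asIdeal ∧ GaloisRep.IsUnramifiedAt v ρ) →
      ∀ t : Π v : Place K, galoisCohomology (ρ.toLocal v) 1,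
        (∀ y : galoisCohomology (ρ.tateDual n) 1,
          (∀ v : HeightOneSpectrum (𝓞 K), (Sum.inr v : Place K) ∉ S →
            galoisCohomology.localization (ρ.tateDual n) (Sum.inr v) 1 y ∈
              unramifiedSubgroup (GaloisRep.toLocal v (ρ.tateDual n)) 1) →
          ∑ v ∈ S, localTatePairingZMod ρ n v (inv v) (t v)
            (galoisCohomology.localization (ρ.tateDual n) v 1 y) = 0) →
        ∃ x : galoisCohomology ρ 1,
          (∀ v : HeightOneSpectrum (𝓞 K), (Sum.inr v : Place K) ∉ S →
            galoisCohomology.localization ρ (Sum.inr v) 1 x ∈ unramifiedSubgroup (GaloisRep.toLocal v ρ) 1) ∧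
          ∀ v ∈ S, galoisCohomology.localization ρ v 1 x = t v) :
    ∀ (S : Finset (Place K)),
      (∀ v : HeightOneSpectrum (𝓞 K), (Sum.inr v : Place K) ∉ S →
        ((n : ℕ) : 𝓞 K) ∉ v.asIdeal ∧ GaloisRep.IsUnramifiedAt v ρ) →
    ∀ (𝓕 𝓖 : SelmerStructure ρ), 𝓕 ≤ 𝓖 → 𝓕.IsUnramifiedOutside S → 𝓖.IsUnramifiedOutside S →
      (∀ t : Π v : Place K, galoisCohomology (ρ.toLocal v) 1, (∀ v ∈ S, t v ∈ 𝓖 v) →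
        (∀ y ∈ (inv.dualSelmerStructure ρ 𝓕).selmerGroup,
          ∑ v ∈ S, localTatePairingZMod ρ n v (inv v) (t v)
            (galoisCohomology.localization (ρ.tateDual n) v 1 y) = 0) →
        ∃ x ∈ 𝓖.selmerGroup, ∀ v ∈ S, galoisCohomology.localization ρ v 1 x - t v ∈ 𝓕 v) ∧
      (∀ u : Π v : Place K, galoisCohomology ((ρ.tateDual n).toLocal v) 1,
        (∀ v ∈ S, u v ∈ inv.dualSelmerStructure ρ 𝓕 v) →
        (∀ x ∈ 𝓖.selmerGroup,
          ∑ v ∈ S, localTatePairingZMod ρ n v (inv v)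
            (galoisCohomology.localization ρ v 1 x) (u v) = 0) →
        ∃ y ∈ (inv.dualSelmerStructure ρ 𝓕).selmerGroup,
          ∀ v ∈ S, galoisCohomology.localization (ρ.tateDual n) v 1 y - u v ∈
            inv.dualSelmerStructure ρ 𝓖 v) := by
  intro S hS 𝓕 𝓖 hle h𝓕 h𝓖
  exact ⟨fun t ht horth => exists_selmer_sub_mem_of_middleExact inv hperf hreal hUO ρ hM hS
      (hE S h𝓕.1 hS) hle h𝓕 h𝓖 t ht horth,
    fun u hu horth => exists_dualSelmer_sub_mem_of_middleExact inv hperf hreal hUO ρ hM hS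
      (dualMiddleExact_of_middleExact inv hperf hreal ρ hM (hE S h𝓕.1 hS)) hle h𝓕 h𝓖 u hu horth⟩

end AtRho

/-! ## §3. The same for THE invariant maps `LocalInvariants.canonical K n` at a prime-power level -/

section Canonical

variable {K : Type} [Field K] [NumberField K]
variable {M : Type} [AddCommGroup M] [TopologicalSpace M] [DiscreteTopology M] [Finite M]

/-- **Howard's Thm. 2.1.11 AT ONE MODULE for THE invariant maps, from Milne I 4.10(b) for that module alone** (prime-power
level `n`; `canonical_isPerfect`, `canonical_injectiveAtRealPlaces`, n1011's `UnramifiedCup.unramifiedOrthogonal_of_isPerfect`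
= Milne I Thm. 2.6). This is the exact E[3]-specific replacement of the ∀-module named fact
`poitouTate_selmerStructure_duality K` in the S2-ENGINE chain of crux 19574 (step (R) parts 2–5), and its hypothesis is the
conclusion shape of the owner's descent certificate `KolyvaginRoadThreePT.middleExact_canonical_of_descentData`.
[cite: Howard2004HeegnerKolyvagin, Thm. 2.1.11 (arXiv:1202.6340 p. 6)] [cite: MilneADT2006, Ch. I, Thm. 4.10(b), Thm. 2.6, Cor. 2.3] -/
theorem selmerComplementAt_canonical_of_middleExact (n : ℕ) [NeZero n] (hn : IsPrimePow n)
    (ρ : DiscreteGaloisModule K M) (hM : ∀ m : M, n • m = 0)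
    (hE : ∀ S : Finset (Place K), (∀ w : InfinitePlace K, (Sum.inl w : Place K) ∈ S) →
      (∀ v : HeightOneSpectrum (𝓞 K), (Sum.inr v : Place K) ∉ S →
        ((n : ℕ) : 𝓞 K) ∉ v.asIdeal ∧ GaloisRep.IsUnramifiedAt v ρ) →
      ∀ t : Π v : Place K, galoisCohomology (ρ.toLocal v) 1,
        (∀ y : galoisCohomology (ρ.tateDual n) 1,
          (∀ v : HeightOneSpectrum (𝓞 K), (Sum.inr v : Place K) ∉ S →
            galoisCohomology.localization (ρ.tateDual n) (Sum.inr v) 1 y ∈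
              unramifiedSubgroup (GaloisRep.toLocal v (ρ.tateDual n)) 1) →
          ∑ v ∈ S, localTatePairingZMod ρ n v (LocalInvariants.canonical K n v) (t v)
            (galoisCohomology.localization (ρ.tateDual n) v 1 y) = 0) →
        ∃ x : galoisCohomology ρ 1,
          (∀ v : HeightOneSpectrum (𝓞 K), (Sum.inr v : Place K) ∉ S →
            galoisCohomology.localization ρ (Sum.inr v) 1 x ∈ unramifiedSubgroup (GaloisRep.toLocal v ρ) 1) ∧
          ∀ v ∈ S, galoisCohomology.localization ρ v 1 x = t v) :
    ∀ (S : Finset (Place K)),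
      (∀ v : HeightOneSpectrum (𝓞 K), (Sum.inr v : Place K) ∉ S →
        ((n : ℕ) : 𝓞 K) ∉ v.asIdeal ∧ GaloisRep.IsUnramifiedAt v ρ) →
    ∀ (𝓕 𝓖 : SelmerStructure ρ), 𝓕 ≤ 𝓖 → 𝓕.IsUnramifiedOutside S → 𝓖.IsUnramifiedOutside S →
      (∀ t : Π v : Place K, galoisCohomology (ρ.toLocal v) 1, (∀ v ∈ S, t v ∈ 𝓖 v) →
        (∀ y ∈ ((LocalInvariants.canonical K n).dualSelmerStructure ρ 𝓕).selmerGroup,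
          ∑ v ∈ S, localTatePairingZMod ρ n v (LocalInvariants.canonical K n v) (t v)
            (galoisCohomology.localization (ρ.tateDual n) v 1 y) = 0) →
        ∃ x ∈ 𝓖.selmerGroup, ∀ v ∈ S, galoisCohomology.localization ρ v 1 x - t v ∈ 𝓕 v) ∧
      (∀ u : Π v : Place K, galoisCohomology ((ρ.tateDual n).toLocal v) 1,
        (∀ v ∈ S, u v ∈ (LocalInvariants.canonical K n).dualSelmerStructure ρ 𝓕 v) →
        (∀ x ∈ 𝓖.selmerGroup,
          ∑ v ∈ S, localTatePairingZMod ρ n v (LocalInvariants.canonical K n v)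
            (galoisCohomology.localization ρ v 1 x) (u v) = 0) →
        ∃ y ∈ ((LocalInvariants.canonical K n).dualSelmerStructure ρ 𝓕).selmerGroup,
          ∀ v ∈ S, galoisCohomology.localization (ρ.tateDual n) v 1 y - u v ∈
            (LocalInvariants.canonical K n).dualSelmerStructure ρ 𝓖 v) :=
  selmerComplementAt_of_middleExact _ LocalInvariants.canonical_isPerfect
    LocalInvariants.canonical_injectiveAtRealPlaces
    (Summit.BirchSwinnertonDyer.Rank1Residual.GaloisImage.UnramifiedCup.unramifiedOrthogonal_of_isPerfect
      _ hn LocalInvariants.canonical_isPerfect) ρ hM hE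

end Canonical

end Summit.BirchSwinnertonDyer.Rank1Residual.X11b.Three.Koly.PTAt

end
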